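import Mathlib
import Summits.Ventures.DiscreteObjects.Mahler.SalemSignCertificate
import Summits.Ventures.DiscreteObjects.Mahler.CensusData10to18

/-!
# Kernel certificates for the degree-18 Salem cores `c18_10`, `c18_14`, `c18_16`, `c18_20` (venture `DiscreteObjects`, target L)

Cell `pub-namedobj`, seat `pub-namedobj-mahler` (gen 10). Framing: lottery ticket; floor = certified
bounds/negative ranges.

Completes the third-engine (kernel) certification of ALL Salem-type cores of degree `≤ 18` of the cell's census
(`CensusData10to18`): with `MRWDegree18Measure` (`c18_01`) and `CensusDeg1618Salem` (`c18_04`, `c18_09`), the seven degree-18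
Salem cores are `c18_01, 04, 09, 10, 14, 16, 20` (`1.18836814…, 1.21972085…, 1.25277593…, 1.25622115…, 1.28461655…,
1.28639596…, 1.29567537…`); all other degree-18 cores have complex trace roots.  Via `salem_certificate_of_signs`.
-/

namespace Summit.Ventures.DiscreteObjects.Mahler

open Polynomial

/-- `traceLift` of the trace polynomial of `c18_10` is the core `c18_10`. -/
theorem traceLift_c18_10 : traceLift (X ^ 9 - X ^ 8 - C 9 * X ^ 7 + C 8 * X ^ 6 + C 26 * X ^ 5 - C 19 * X ^ 4 - C 25 * X ^ 3 + C 12 * X ^ 2 + C 4 * X - 1 : ℤ[X]) = ofCoeffs c18_10 := by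
  have hdeg : (X ^ 9 - X ^ 8 - C 9 * X ^ 7 + C 8 * X ^ 6 + C 26 * X ^ 5 - C 19 * X ^ 4 - C 25 * X ^ 3 + C 12 * X ^ 2 + C 4 * X - 1 : ℤ[X]).natDegree = 9 := by compute_degree!
  have hP : ofCoeffs c18_10 = (X ^ 18 - X ^ 17 - X ^ 14 + X ^ 13 - X ^ 9 + X ^ 5 - X ^ 4 - X + 1 : ℤ[X]) := by
    unfold ofCoeffs c18_10; simp [List.zipIdx]; ring
  rw [hP, traceLift, hdeg]
  simp only [Finset.sum_range_succ, Finset.sum_range_zero, zero_add, coeff_add, coeff_sub, coeff_X_pow,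
    coeff_C_mul, coeff_X, coeff_one]
  norm_num
  ring

/-- **`1.25622115 < M(c18_10) < 1.25622116`** — a degree-18 Salem number (census core). -/
theorem c18_10_measure_enclosure :
    (125622115 / 10 ^ 8 : ℝ) < intMahlerMeasure (ofCoeffs c18_10) ∧
      intMahlerMeasure (ofCoeffs c18_10) < 125622116 / 10 ^ 8 := by
  set Q : ℤ[X] := X ^ 9 - X ^ 8 - C 9 * X ^ 7 + C 8 * X ^ 6 + C 26 * X ^ 5 - C 19 * X ^ 4 - C 25 * X ^ 3 + C 12 * X ^ 2 + C 4 * X - 1 with hQdef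
  have hQmonic : Q.Monic := by rw [hQdef]; monicity!
  have hQdeg : Q.natDegree = 9 := by rw [hQdef]; compute_degree!
  have hev : ∀ y : ℝ, aeval y Q = y ^ 9 - y ^ 8 - 9 * y ^ 7 + 8 * y ^ 6 + 26 * y ^ 5 - 19 * y ^ 4 - 25 * y ^ 3 + 12 * y ^ 2 + 4 * y - 1 := by
    intro y
    rw [hQdef]
    simp only [map_add, map_sub, map_mul, map_pow, aeval_X, map_ofNat, map_one]
  set c₁ : ℝ := 125622115 / 10 ^ 8 with hc₁
  set c₂ : ℝ := 125622116 / 10 ^ 8 with hc₂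
  obtain ⟨y, hya, hyb, hM1, hMM⟩ := salem_certificate_of_signs hQmonic
    [-2, -9/5, -3/2, -1, 0, 1/2, 1, 7/4, 2] (by rw [hQdeg]; rfl)
    (by simp only [List.isChain_cons_cons, List.isChain_singleton, and_true]; norm_num)
    (by intro p hp; simp only [List.mem_cons, List.mem_nil_iff, or_false] at hp
        rcases hp with rfl | rfl | rfl | rfl | rfl | rfl | rfl | rfl | rfl <;> norm_num)
    (by simp only [List.isChain_cons_cons, List.isChain_singleton, and_true, hev]; norm_num)
    (a := c₁ + c₁⁻¹) (b := c₂ + c₂⁻¹) (by rw [hc₁, hc₂]; norm_num)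
    (Or.inr (by rw [hc₁]; norm_num)) (by rw [hev, hev, hc₁, hc₂]; norm_num)
  rw [traceLift_c18_10] at hM1 hMM
  have hc1y : 2 < c₁ + c₁⁻¹ := by rw [hc₁]; norm_num
  rw [abs_of_pos (by linarith)] at hMM
  have hMpos : 0 < intMahlerMeasure (ofCoeffs c18_10) := by linarith
  constructor
  · have h : c₁ + c₁⁻¹ < intMahlerMeasure (ofCoeffs c18_10) + (intMahlerMeasure (ofCoeffs c18_10))⁻¹ := by
      rw [hMM]; linarith
    exact lt_of_add_inv_lt_add_inv hM1.le (by rw [hc₁]; norm_num) h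
  · have h : intMahlerMeasure (ofCoeffs c18_10) + (intMahlerMeasure (ofCoeffs c18_10))⁻¹ < c₂ + c₂⁻¹ := by
      rw [hMM]; linarith
    exact lt_of_add_inv_lt_add_inv (by rw [hc₂]; norm_num) hMpos h

/-- `traceLift` of the trace polynomial of `c18_14` is the core `c18_14`. -/
theorem traceLift_c18_14 : traceLift (X ^ 9 - C 9 * X ^ 7 + C 26 * X ^ 5 - C 26 * X ^ 3 - X ^ 2 + C 7 * X + 1 : ℤ[X]) = ofCoeffs c18_14 := by
  have hdeg : (X ^ 9 - C 9 * X ^ 7 + C 26 * X ^ 5 - C 26 * X ^ 3 - X ^ 2 + C 7 * X + 1 : ℤ[X]).natDegree = 9 := by compute_degree!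
  have hP : ofCoeffs c18_14 = (X ^ 18 - X ^ 14 - X ^ 12 - X ^ 11 - X ^ 9 - X ^ 7 - X ^ 6 - X ^ 4 + 1 : ℤ[X]) := by
    unfold ofCoeffs c18_14; simp [List.zipIdx]; ring
  rw [hP, traceLift, hdeg]
  simp only [Finset.sum_range_succ, Finset.sum_range_zero, zero_add, coeff_add, coeff_sub, coeff_X_pow,
    coeff_C_mul, coeff_X, coeff_one]
  norm_num
  ring

/-- **`1.28461655 < M(c18_14) < 1.28461656`** — a degree-18 Salem number (census core). -/
theorem c18_14_measure_enclosure :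
    (128461655 / 10 ^ 8 : ℝ) < intMahlerMeasure (ofCoeffs c18_14) ∧
      intMahlerMeasure (ofCoeffs c18_14) < 128461656 / 10 ^ 8 := by
  set Q : ℤ[X] := X ^ 9 - C 9 * X ^ 7 + C 26 * X ^ 5 - C 26 * X ^ 3 - X ^ 2 + C 7 * X + 1 with hQdef
  have hQmonic : Q.Monic := by rw [hQdef]; monicity!
  have hQdeg : Q.natDegree = 9 := by rw [hQdef]; compute_degree!
  have hev : ∀ y : ℝ, aeval y Q = y ^ 9 - 9 * y ^ 7 + 26 * y ^ 5 - 26 * y ^ 3 - y ^ 2 + 7 * y + 1 := by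
    intro y
    rw [hQdef]
    simp only [map_add, map_sub, map_mul, map_pow, aeval_X, map_ofNat, map_one]
  set c₁ : ℝ := 128461655 / 10 ^ 8 with hc₁
  set c₂ : ℝ := 128461656 / 10 ^ 8 with hc₂
  obtain ⟨y, hya, hyb, hM1, hMM⟩ := salem_certificate_of_signs hQmonic
    [-2, -19/10, -3/2, -1, -1/2, 0, 1, 3/2, 2] (by rw [hQdeg]; rfl)
    (by simp only [List.isChain_cons_cons, List.isChain_singleton, and_true]; norm_num)
    (by intro p hp; simp only [List.mem_cons, List.mem_nil_iff, or_false] at hp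
        rcases hp with rfl | rfl | rfl | rfl | rfl | rfl | rfl | rfl | rfl <;> norm_num)
    (by simp only [List.isChain_cons_cons, List.isChain_singleton, and_true, hev]; norm_num)
    (a := c₁ + c₁⁻¹) (b := c₂ + c₂⁻¹) (by rw [hc₁, hc₂]; norm_num)
    (Or.inr (by rw [hc₁]; norm_num)) (by rw [hev, hev, hc₁, hc₂]; norm_num)
  rw [traceLift_c18_14] at hM1 hMM
  have hc1y : 2 < c₁ + c₁⁻¹ := by rw [hc₁]; norm_num
  rw [abs_of_pos (by linarith)] at hMM
  have hMpos : 0 < intMahlerMeasure (ofCoeffs c18_14) := by linarith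
  constructor
  · have h : c₁ + c₁⁻¹ < intMahlerMeasure (ofCoeffs c18_14) + (intMahlerMeasure (ofCoeffs c18_14))⁻¹ := by
      rw [hMM]; linarith
    exact lt_of_add_inv_lt_add_inv hM1.le (by rw [hc₁]; norm_num) h
  · have h : intMahlerMeasure (ofCoeffs c18_14) + (intMahlerMeasure (ofCoeffs c18_14))⁻¹ < c₂ + c₂⁻¹ := by
      rw [hMM]; linarith
    exact lt_of_add_inv_lt_add_inv (by rw [hc₂]; norm_num) hMpos h

/-- `traceLift` of the trace polynomial of `c18_16` is the core `c18_16`. -/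
theorem traceLift_c18_16 : traceLift (X ^ 9 - C 2 * X ^ 8 - C 7 * X ^ 7 + C 14 * X ^ 6 + C 15 * X ^ 5 - C 30 * X ^ 4 - C 10 * X ^ 3 + C 19 * X ^ 2 + C 2 * X - 1 : ℤ[X]) = ofCoeffs c18_16 := by
  have hdeg : (X ^ 9 - C 2 * X ^ 8 - C 7 * X ^ 7 + C 14 * X ^ 6 + C 15 * X ^ 5 - C 30 * X ^ 4 - C 10 * X ^ 3 + C 19 * X ^ 2 + C 2 * X - 1 : ℤ[X]).natDegree = 9 := by compute_degree!
  have hP : ofCoeffs c18_16 = (X ^ 18 - 2 * X ^ 17 + 2 * X ^ 16 - 2 * X ^ 15 + 2 * X ^ 14 - 2 * X ^ 13 + 2 * X ^ 12 - 3 * X ^ 11 + 3 * X ^ 10 - 3 * X ^ 9 + 3 * X ^ 8 - 3 * X ^ 7 + 2 * X ^ 6 - 2 * X ^ 5 + 2 * X ^ 4 - 2 * X ^ 3 + 2 * X ^ 2 - 2 * X + 1 : ℤ[X]) := by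
    unfold ofCoeffs c18_16; simp [List.zipIdx]; ring
  rw [hP, traceLift, hdeg]
  simp only [Finset.sum_range_succ, Finset.sum_range_zero, zero_add, coeff_add, coeff_sub, coeff_X_pow,
    coeff_C_mul, coeff_X, coeff_one]
  norm_num
  ring

/-- **`1.28639596 < M(c18_16) < 1.28639597`** — a degree-18 Salem number (census core). -/
theorem c18_16_measure_enclosure :
    (128639596 / 10 ^ 8 : ℝ) < intMahlerMeasure (ofCoeffs c18_16) ∧
      intMahlerMeasure (ofCoeffs c18_16) < 128639597 / 10 ^ 8 := by
  set Q : ℤ[X] := X ^ 9 - C 2 * X ^ 8 - C 7 * X ^ 7 + C 14 * X ^ 6 + C 15 * X ^ 5 - C 30 * X ^ 4 - C 10 * X ^ 3 + C 19 * X ^ 2 + C 2 * X - 1 with hQdef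
  have hQmonic : Q.Monic := by rw [hQdef]; monicity!
  have hQdeg : Q.natDegree = 9 := by rw [hQdef]; compute_degree!
  have hev : ∀ y : ℝ, aeval y Q = y ^ 9 - 2 * y ^ 8 - 7 * y ^ 7 + 14 * y ^ 6 + 15 * y ^ 5 - 30 * y ^ 4 - 10 * y ^ 3 + 19 * y ^ 2 + 2 * y - 1 := by
    intro y
    rw [hQdef]
    simp only [map_add, map_sub, map_mul, map_pow, aeval_X, map_ofNat, map_one]
  set c₁ : ℝ := 128639596 / 10 ^ 8 with hc₁
  set c₂ : ℝ := 128639597 / 10 ^ 8 with hc₂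
  obtain ⟨y, hya, hyb, hM1, hMM⟩ := salem_certificate_of_signs hQmonic
    [-2, -7/4, -1, -1/2, 0, 1, 5/4, 3/2, 2] (by rw [hQdeg]; rfl)
    (by simp only [List.isChain_cons_cons, List.isChain_singleton, and_true]; norm_num)
    (by intro p hp; simp only [List.mem_cons, List.mem_nil_iff, or_false] at hp
        rcases hp with rfl | rfl | rfl | rfl | rfl | rfl | rfl | rfl | rfl <;> norm_num)
    (by simp only [List.isChain_cons_cons, List.isChain_singleton, and_true, hev]; norm_num)
    (a := c₁ + c₁⁻¹) (b := c₂ + c₂⁻¹) (by rw [hc₁, hc₂]; norm_num)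
    (Or.inr (by rw [hc₁]; norm_num)) (by rw [hev, hev, hc₁, hc₂]; norm_num)
  rw [traceLift_c18_16] at hM1 hMM
  have hc1y : 2 < c₁ + c₁⁻¹ := by rw [hc₁]; norm_num
  rw [abs_of_pos (by linarith)] at hMM
  have hMpos : 0 < intMahlerMeasure (ofCoeffs c18_16) := by linarith
  constructor
  · have h : c₁ + c₁⁻¹ < intMahlerMeasure (ofCoeffs c18_16) + (intMahlerMeasure (ofCoeffs c18_16))⁻¹ := by
      rw [hMM]; linarith
    exact lt_of_add_inv_lt_add_inv hM1.le (by rw [hc₁]; norm_num) h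
  · have h : intMahlerMeasure (ofCoeffs c18_16) + (intMahlerMeasure (ofCoeffs c18_16))⁻¹ < c₂ + c₂⁻¹ := by
      rw [hMM]; linarith
    exact lt_of_add_inv_lt_add_inv (by rw [hc₂]; norm_num) hMpos h

/-- `traceLift` of the trace polynomial of `c18_20` is the core `c18_20`. -/
theorem traceLift_c18_20 : traceLift (X ^ 9 - X ^ 8 - C 9 * X ^ 7 + C 8 * X ^ 6 + C 26 * X ^ 5 - C 19 * X ^ 4 - C 26 * X ^ 3 + C 12 * X ^ 2 + C 8 * X - 1 : ℤ[X]) = ofCoeffs c18_20 := by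
  have hdeg : (X ^ 9 - X ^ 8 - C 9 * X ^ 7 + C 8 * X ^ 6 + C 26 * X ^ 5 - C 19 * X ^ 4 - C 26 * X ^ 3 + C 12 * X ^ 2 + C 8 * X - 1 : ℤ[X]).natDegree = 9 := by compute_degree!
  have hP : ofCoeffs c18_20 = (X ^ 18 - X ^ 17 - X ^ 14 + X ^ 13 - X ^ 12 + X ^ 10 - X ^ 9 + X ^ 8 - X ^ 6 + X ^ 5 - X ^ 4 - X + 1 : ℤ[X]) := by
    unfold ofCoeffs c18_20; simp [List.zipIdx]; ring
  rw [hP, traceLift, hdeg]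
  simp only [Finset.sum_range_succ, Finset.sum_range_zero, zero_add, coeff_add, coeff_sub, coeff_X_pow,
    coeff_C_mul, coeff_X, coeff_one]
  norm_num
  ring

/-- **`1.29567537 < M(c18_20) < 1.29567538`** — a degree-18 Salem number (census core). -/
theorem c18_20_measure_enclosure :
    (129567537 / 10 ^ 8 : ℝ) < intMahlerMeasure (ofCoeffs c18_20) ∧
      intMahlerMeasure (ofCoeffs c18_20) < 129567538 / 10 ^ 8 := by
  set Q : ℤ[X] := X ^ 9 - X ^ 8 - C 9 * X ^ 7 + C 8 * X ^ 6 + C 26 * X ^ 5 - C 19 * X ^ 4 - C 26 * X ^ 3 + C 12 * X ^ 2 + C 8 * X - 1 with hQdef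
  have hQmonic : Q.Monic := by rw [hQdef]; monicity!
  have hQdeg : Q.natDegree = 9 := by rw [hQdef]; compute_degree!
  have hev : ∀ y : ℝ, aeval y Q = y ^ 9 - y ^ 8 - 9 * y ^ 7 + 8 * y ^ 6 + 26 * y ^ 5 - 19 * y ^ 4 - 26 * y ^ 3 + 12 * y ^ 2 + 8 * y - 1 := by
    intro y
    rw [hQdef]
    simp only [map_add, map_sub, map_mul, map_pow, aeval_X, map_ofNat, map_one]
  set c₁ : ℝ := 129567537 / 10 ^ 8 with hc₁
  set c₂ : ℝ := 129567538 / 10 ^ 8 with hc₂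
  obtain ⟨y, hya, hyb, hM1, hMM⟩ := salem_certificate_of_signs hQmonic
    [-2, -19/10, -1, -3/4, 0, 1/2, 1, 3/2, 2] (by rw [hQdeg]; rfl)
    (by simp only [List.isChain_cons_cons, List.isChain_singleton, and_true]; norm_num)
    (by intro p hp; simp only [List.mem_cons, List.mem_nil_iff, or_false] at hp
        rcases hp with rfl | rfl | rfl | rfl | rfl | rfl | rfl | rfl | rfl <;> norm_num)
    (by simp only [List.isChain_cons_cons, List.isChain_singleton, and_true, hev]; norm_num)
    (a := c₁ + c₁⁻¹) (b := c₂ + c₂⁻¹) (by rw [hc₁, hc₂]; norm_num)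
    (Or.inr (by rw [hc₁]; norm_num)) (by rw [hev, hev, hc₁, hc₂]; norm_num)
  rw [traceLift_c18_20] at hM1 hMM
  have hc1y : 2 < c₁ + c₁⁻¹ := by rw [hc₁]; norm_num
  rw [abs_of_pos (by linarith)] at hMM
  have hMpos : 0 < intMahlerMeasure (ofCoeffs c18_20) := by linarith
  constructor
  · have h : c₁ + c₁⁻¹ < intMahlerMeasure (ofCoeffs c18_20) + (intMahlerMeasure (ofCoeffs c18_20))⁻¹ := by
      rw [hMM]; linarith
    exact lt_of_add_inv_lt_add_inv hM1.le (by rw [hc₁]; norm_num) h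
  · have h : intMahlerMeasure (ofCoeffs c18_20) + (intMahlerMeasure (ofCoeffs c18_20))⁻¹ < c₂ + c₂⁻¹ := by
      rw [hMM]; linarith
    exact lt_of_add_inv_lt_add_inv (by rw [hc₂]; norm_num) hMpos h

end Summit.Ventures.DiscreteObjects.Mahler
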